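import Summits.CriticalPhenomena.Ising3DConformalLimit.Theses.ReflectionTwin
import Summits.CriticalPhenomena.Ising3DConformalLimit.Theorems.MoebiusLimitExists.Negative.TwoPointPositivity
import Summits.CriticalPhenomena.Ising3DConformalLimit.Theorems.MoebiusLimitExists.Negative.ScaleFree
import Summits.CriticalPhenomena.Ising3DConformalLimit.Theorems.MoebiusLimitExists.Negative.OnlyInteractionTightness
import Literature.Probability.LatticeModels.CriticalTwoPointLawDimension
import HarnessLib

/-!
# `ExistsContinuousLimit` (item stmt-CriticalPhenomena-4582): the continuity clause is TIGHT —
refuted strengthenings of the crux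

Negative / structural knowledge about the crux
`Summit.CriticalPhenomena.Ising3DConformalLimit.Theses.ReflectionTwin.ExistsContinuousLimit`
(shared verbatim with `LogPolarProxy.ExistsContinuousLimit`), from the standing crux disprover's work file
`Cruxes/ExistsContinuousLimit/Disproof.lean` (cycle 1), THEOREM-ONLY (no definitions, no named facts; the
strengthened variants are written inline). No theorem here asserts a route item.

The crux asks for a pointwise scaling limit `S` of `criticalCorr 3` which is, among other things,
`Δ`-scale covariant (`Δ > 0`), non-degenerate (`S₂ > 0` off the diagonal) and continuous ON
`NonCoincident`. The continuity clause is free (mesh continuity, `stub_limitContinuity`, p146967); this file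
shows it is also tight, and that the restriction to `NonCoincident` and the word "locally" in the
convergence clause are load-bearing. Everything follows from the dilation orbit of ONE pair,
`S₂(c x) = c^{−2Δ} S₂(x) → ∞` as `c → 0⁺` (`two_tendsto_atTop_along_dilations`):

* `not_continuousAt_two_zero`: NO `Δ`-scale-covariant (`Δ > 0`) family with `S₂ > 0` at one pair is
  continuous at the diagonal point `(0,0)`, whatever value it takes there; hence
  `not_existsContinuousLimit_everywhereContinuous` (clause (5) cannot be upgraded to `Continuous (S n)`).
* `two_not_bddAbove`: `S₂` is unbounded on `NonCoincident 3 2` (no uniform continuity / boundedness).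
* `not_existsContinuousLimit_uniformLimit`: the convergence cannot be UNIFORM on `NonCoincident 3 2`
  (the lattice side is bounded by `ρ(δ)²`, `|⟨σσ⟩| ≤ 1`).
* `not_limitOnUniv`, `not_existsContinuousLimit_limitOnUniv`: the rescaled critical pair correlator cannot
  converge locally uniformly on ALL of `(ℝ³)²` to a family non-degenerate at `(0,e₀)`: on the diagonal it
  equals `ρ(δ)²` (`σ² = 1`), while `ρ(δ)² ⟨σ₀σ_{⌊1/δ⌋e₀}⟩_{β_c} → S₂(0,e₀) > 0` and the infrared decay
  `⟨σ₀σ_{⌊1/δ⌋e₀}⟩_{β_c} → 0` (`criticalTwoPoint_floor_tendsto_zero`) force `ρ(δ)² → ∞`.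

References: folklore; tree API `ScalingLimit.lean`, `ConformalCovariance.lean`,
`CriticalTwoPointLawDimension.lean` (`criticalTwoPoint_tendsto_zero_cofinite`).
-/

noncomputable section

namespace Summit.CriticalPhenomena.Ising3DConformalLimit.ExistsContinuousLimitNegative

open Literature.Probability.LatticeModels Filter Set
open scoped Topology
open Summit.CriticalPhenomena.Ising3DConformalLimit.Theses
open Summit.CriticalPhenomena.Ising3DConformalLimit.MoebiusLimitExistsNegative
  (rescaledCorrelator_axisPair smul_mem_nonCoincident_iff)
open Summit.CriticalPhenomena.Ising3DConformalLimit.OnlyInteractionTightness (abs_rescaledCorrelator_le)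

/-! ### The dilation orbit of one pair -/

/-- Scale covariance read on pairs: `S₂(c x) = c^{−2Δ} S₂(x)`. [folklore] -/
theorem two_smul_eq {Δ : ℝ} {S : CorrFamily 3} (hsc : IsScaleCovariant Δ S) {c : ℝ} (hc : 0 < c)
    (x : Fin 2 → EuclideanSpace ℝ (Fin 3)) :
    S 2 (fun i => c • x i) = c ^ (-(2 * Δ)) * S 2 x := by
  rw [hsc 2 c hc x]
  norm_num

/-- **The two-point function of ANY `Δ`-scale-covariant (`Δ > 0`) family tends to `+∞` along the
dilations `c → 0⁺` of a pair at which it is positive.** [folklore] -/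
theorem two_tendsto_atTop_along_dilations {Δ : ℝ} {S : CorrFamily 3} (hΔ : 0 < Δ)
    (hsc : IsScaleCovariant Δ S) {x : Fin 2 → EuclideanSpace ℝ (Fin 3)} (hpos : 0 < S 2 x) :
    Tendsto (fun c : ℝ => S 2 (fun i => c • x i)) (𝓝[>] (0:ℝ)) atTop := by
  have hpow : Tendsto (fun c : ℝ => c ^ (-(2 * Δ))) (𝓝[>] (0:ℝ)) atTop := by
    have h := (tendsto_rpow_atTop (by positivity : 0 < 2 * Δ)).comp tendsto_inv_nhdsGT_zero
    refine h.congr' ?_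
    filter_upwards [self_mem_nhdsWithin] with c hc
    simp only [Function.comp_apply]
    rw [Real.inv_rpow (le_of_lt hc), Real.rpow_neg (le_of_lt hc)]
  refine (hpow.atTop_mul_const hpos).congr' ?_
  filter_upwards [self_mem_nhdsWithin] with c hc
  exact (two_smul_eq hsc hc x).symm

/-! ### Continuity cannot reach the diagonal -/

/-- **No `Δ`-scale-covariant (`Δ > 0`) family positive at one pair is continuous at the diagonal point
`(0,0)`**, whatever value it takes there (the dilates `c x` of the pair tend to `(0,0)` while `S₂(c x) → ∞`).
So the crux's clause `ContinuousOn (S n) (NonCoincident 3 n)` cannot be strengthened to continuity on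
`(ℝ³)ⁿ`: the restriction is forced by `0 < Δ`, non-degeneracy and scale covariance alone. [folklore] -/
theorem not_continuousAt_two_zero {Δ : ℝ} {S : CorrFamily 3} (hΔ : 0 < Δ)
    (hsc : IsScaleCovariant Δ S) {x : Fin 2 → EuclideanSpace ℝ (Fin 3)} (hpos : 0 < S 2 x) :
    ¬ ContinuousAt (S 2) (fun _ => 0) := by
  intro hcont
  have hg : Continuous fun c : ℝ => (fun i => c • x i : Fin 2 → EuclideanSpace ℝ (Fin 3)) := by
    fun_prop
  have h0 : (fun i => (0:ℝ) • x i) = (fun _ => 0 : Fin 2 → EuclideanSpace ℝ (Fin 3)) := by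
    funext i; simp
  have hlim0 : Tendsto (fun c : ℝ => (fun i => c • x i : Fin 2 → EuclideanSpace ℝ (Fin 3)))
      (𝓝 0) (𝓝 (fun _ => 0)) := by
    have h := hg.tendsto 0
    rwa [h0] at h
  have h1 : Tendsto (fun c : ℝ => S 2 (fun i => c • x i)) (𝓝[>] (0:ℝ)) (𝓝 (S 2 (fun _ => 0))) :=
    (hcont.tendsto.comp hlim0).mono_left nhdsWithin_le_nhds
  exact not_tendsto_nhds_of_tendsto_atTop (two_tendsto_atTop_along_dilations hΔ hsc hpos) _ h1

/-- REFUTED STRENGTHENING of `ExistsContinuousLimit` (continuity everywhere): no triple satisfies the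
clauses of the crux with `ContinuousOn (S n) (NonCoincident 3 n)` upgraded to `Continuous (S n)`.
Only `0 < Δ`, non-degeneracy, scale covariance and continuity of `S 2` at ONE diagonal point are used.
[folklore] -/
theorem not_existsContinuousLimit_everywhereContinuous :
    ¬ ∃ (ρ : ℝ → ℝ) (Δ : ℝ) (S : CorrFamily 3), (∀ δ ∈ Set.Ioc (0:ℝ) 1, 0 < ρ δ) ∧ 0 < Δ ∧
      HasPointwiseScalingLimit (criticalCorr 3) ρ S ∧ (∀ n z, z ∉ NonCoincident 3 n → S n z = 0) ∧
      (∀ n, Continuous (S n)) ∧ IsNondegenerateTwoPoint S ∧ IsTranslationInvariant S ∧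
      IsScaleCovariant Δ S := by
  rintro ⟨ρ, Δ, S, -, hΔ, -, -, hcont, hnd, -, hsc⟩
  exact not_continuousAt_two_zero hΔ hsc (hnd _ (zero_unitVec_mem_nonCoincident one_ne_zero))
    (hcont 2).continuousAt

/-- `S₂` of a `Δ`-scale-covariant (`Δ > 0`) family positive at one non-coincident pair is unbounded above
on `NonCoincident 3 2`: continuity on `NonCoincident` cannot be upgraded to uniform continuity or
boundedness there either. [folklore] -/
theorem two_not_bddAbove {Δ : ℝ} {S : CorrFamily 3} (hΔ : 0 < Δ) (hsc : IsScaleCovariant Δ S)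
    {x : Fin 2 → EuclideanSpace ℝ (Fin 3)} (hx : x ∈ NonCoincident 3 2) (hpos : 0 < S 2 x) (M : ℝ) :
    ∃ y ∈ NonCoincident 3 2, M < S 2 y := by
  have h := (two_tendsto_atTop_along_dilations hΔ hsc hpos).eventually_gt_atTop M
  obtain ⟨c, hcM, hc⟩ := (h.and self_mem_nhdsWithin).exists
  exact ⟨fun i => c • x i, (smul_mem_nonCoincident_iff (ne_of_gt hc) x).2 hx, hcM⟩

/-! ### "Locally" and "on `NonCoincident`" in the convergence clause are load-bearing -/

/-- REFUTED STRENGTHENING of `ExistsContinuousLimit` (uniform convergence): the rescaled critical pair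
correlator cannot converge UNIFORMLY on `NonCoincident 3 2` to a `Δ`-scale-covariant (`Δ > 0`)
non-degenerate family — at a fixed mesh it is bounded by `ρ(δ)²` (`|⟨σσ⟩_{β_c}| ≤ 1`) while the limit is
unbounded. [folklore] -/
theorem not_existsContinuousLimit_uniformLimit :
    ¬ ∃ (ρ : ℝ → ℝ) (Δ : ℝ) (S : CorrFamily 3), 0 < Δ ∧
      TendstoUniformlyOn (rescaledCorrelator (criticalCorr 3) ρ 2) (S 2) (𝓝[>] (0:ℝ)) (NonCoincident 3 2) ∧
      IsNondegenerateTwoPoint S ∧ IsScaleCovariant Δ S := by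
  rintro ⟨ρ, Δ, S, hΔ, hU, hnd, hsc⟩
  obtain ⟨δ, hδ⟩ := ((Metric.tendstoUniformlyOn_iff.1 hU) 1 one_pos).exists
  have hx := zero_unitVec_mem_nonCoincident (one_ne_zero (α := ℝ))
  obtain ⟨y, hy, hMy⟩ := two_not_bddAbove hΔ hsc hx (hnd _ hx) (|ρ δ| ^ 2 + 1)
  have hd := hδ y hy
  rw [Real.dist_eq] at hd
  have hb := abs_rescaledCorrelator_le ρ 2 δ y
  have hlt : S 2 y < |ρ δ| ^ 2 + 1 := by
    have h := abs_sub_lt_iff.1 hd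
    linarith [le_abs_self (rescaledCorrelator (criticalCorr 3) ρ 2 δ y)]
  linarith

/-- `⟨σ₀ σ_{⌊1/δ⌋ e₀}⟩_{β_c} → 0` as `δ → 0⁺` on `ℤ³` (the critical two-point function vanishes at infinity,
`criticalTwoPoint_tendsto_zero_cofinite`, read along the axis sites `⌊1/δ⌋ e₀ → ∞`). [folklore] -/
theorem criticalTwoPoint_floor_tendsto_zero :
    Tendsto (fun δ : ℝ => criticalTwoPoint 3 (Pi.single (0 : Fin 3) ⌊1 / δ⌋)) (𝓝[>] (0:ℝ)) (𝓝 0) := by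
  have hinv : Tendsto (fun δ : ℝ => 1 / δ) (𝓝[>] (0:ℝ)) atTop := by
    simpa only [one_div] using tendsto_inv_nhdsGT_zero
  have hfl : Tendsto (fun δ : ℝ => ⌊1 / δ⌋) (𝓝[>] (0:ℝ)) atTop :=
    (tendsto_floor_atTop (α := ℝ)).comp hinv
  have hsingle : Tendsto (fun m : ℤ => (Pi.single (0 : Fin 3) m : Site 3)) cofinite cofinite :=
    (Pi.single_injective (M := fun _ : Fin 3 => ℤ) (0 : Fin 3)).tendsto_cofinite
  exact criticalTwoPoint_tendsto_zero_cofinite.comp (hsingle.comp (hfl.mono_right atTop_le_cofinite))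

/-- **The restriction to `NonCoincident` in the convergence clause is load-bearing**: the rescaled critical
pair correlator cannot converge locally uniformly on ALL of `(ℝ³)²` to a family positive at `(0,e₀)` — on
the diagonal it equals `ρ(δ)²` (`σ² = 1`), which would have to converge, while
`ρ(δ)² ⟨σ₀σ_{⌊1/δ⌋e₀}⟩_{β_c} → S₂(0,e₀) > 0` and `⟨σ₀σ_{⌊1/δ⌋e₀}⟩_{β_c} → 0` force `ρ(δ)² → ∞`. [folklore] -/
theorem not_limitOnUniv {ρ : ℝ → ℝ} {S : CorrFamily 3}
    (hU : TendstoLocallyUniformlyOn (rescaledCorrelator (criticalCorr 3) ρ 2) (S 2) (𝓝[>] (0:ℝ)) univ)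
    (hpos : 0 < S 2 (![0, EuclideanSpace.single (0 : Fin 3) (1:ℝ)] : Fin 2 → EuclideanSpace ℝ (Fin 3))) :
    False := by
  have h0' : Tendsto (fun δ => ρ δ ^ 2) (𝓝[>] (0:ℝ))
      (𝓝 (S 2 (![0, EuclideanSpace.single (0 : Fin 3) (0:ℝ)] : Fin 2 → EuclideanSpace ℝ (Fin 3)))) := by
    refine (hU.tendsto_at (mem_univ _)).congr fun δ => ?_
    rw [rescaledCorrelator_axisPair]
    simp [criticalTwoPoint_zero']
  have h1' : Tendsto (fun δ => ρ δ ^ 2 * criticalTwoPoint 3 (Pi.single (0 : Fin 3) ⌊1 / δ⌋))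
      (𝓝[>] (0:ℝ)) (𝓝 (S 2 (![0, EuclideanSpace.single (0 : Fin 3) (1:ℝ)]))) := by
    refine (hU.tendsto_at (mem_univ _)).congr fun δ => ?_
    rw [rescaledCorrelator_axisPair]
  have h2 := h0'.mul criticalTwoPoint_floor_tendsto_zero
  rw [mul_zero] at h2
  have h := tendsto_nhds_unique h1' h2
  linarith

/-- REFUTED STRENGTHENING of `ExistsContinuousLimit` (limit on all of `(ℝ³)ⁿ`): no renormalisation makes
the critical `ℤ³` correlators converge locally uniformly EVERYWHERE to a non-degenerate family. [folklore] -/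
theorem not_existsContinuousLimit_limitOnUniv :
    ¬ ∃ (ρ : ℝ → ℝ) (S : CorrFamily 3),
      (∀ n, TendstoLocallyUniformlyOn (rescaledCorrelator (criticalCorr 3) ρ n) (S n) (𝓝[>] (0:ℝ)) univ) ∧
      IsNondegenerateTwoPoint S := by
  rintro ⟨ρ, S, hU, hnd⟩
  exact not_limitOnUniv (hU 2) (hnd _ (zero_unitVec_mem_nonCoincident one_ne_zero))

/-- Summary in the shape of the crux: every witness `(ρ, Δ, S)` of `ReflectionTwin.ExistsContinuousLimit`
has `S 2` discontinuous at `(0,0)` and unbounded on `NonCoincident 3 2` — the clause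
`ContinuousOn (S n) (NonCoincident 3 n)` is all the continuity one can ask. [folklore] -/
theorem existsContinuousLimit_witness_not_continuousAt_zero {ρ : ℝ → ℝ} {Δ : ℝ} {S : CorrFamily 3}
    (h : (∀ δ ∈ Set.Ioc (0:ℝ) 1, 0 < ρ δ) ∧ 0 < Δ ∧ HasPointwiseScalingLimit (criticalCorr 3) ρ S ∧
      (∀ n z, z ∉ NonCoincident 3 n → S n z = 0) ∧ (∀ n, ContinuousOn (S n) (NonCoincident 3 n)) ∧
      IsNondegenerateTwoPoint S ∧ IsTranslationInvariant S ∧ IsScaleCovariant Δ S) :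
    ¬ ContinuousAt (S 2) (fun _ => 0) ∧ ∀ M : ℝ, ∃ x ∈ NonCoincident 3 2, M < S 2 x :=
  have hx := zero_unitVec_mem_nonCoincident (one_ne_zero (α := ℝ))
  ⟨not_continuousAt_two_zero h.2.1 h.2.2.2.2.2.2.2 (h.2.2.2.2.2.1 _ hx),
    two_not_bddAbove h.2.1 h.2.2.2.2.2.2.2 hx (h.2.2.2.2.2.1 _ hx)⟩

end Summit.CriticalPhenomena.Ising3DConformalLimit.ExistsContinuousLimitNegative

end
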